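import Literature.AlgebraicGeometry.Resolution.CentreBlowupTransverseH
import Literature.AlgebraicGeometry.Resolution.CentreBlowupExample31
import Mathlib.Algebra.MvPolynomial.PDeriv
import HarnessLib

/-!
# [Cossart–Piltant 2019, Proposition 3.3] in the coordinate-centre model: the initial form at a
# permissible centre of the second kind, and `ε(y) = ω(x)`

[CP19, Prop. 3.3 (p. 32)]: "Let `𝒴` be permissible of the second kind at `x`. For any well adapted
coordinates `(u₁,…,u_n;Z)` at `x` such that `I(W) = ({u_j}_{j∈J})`, the initial form `in_{m_S} h ∈ G(m_S)[Z]`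
satisfies
  `H⁻¹G^p ⊆ U_{j₀} k(x)[{U_j}_{j∈J}]_{ε(y)}` for some `j₀ ∈ (J')_E`,
  `H⁻¹F_{p,Z} = < Σ_{j'∈J'} U_{j'} Φ_{j'}({U_j}_{j∈J}) + Ψ({U_j}_{j∈J}) > ⊆ G(m_S)_{ε(x)}`      (3.3.1)
with `Φ_{j'} ≠ 0` for some `j' ∈ J' ∖ (J')_E`. In particular `ε(y) = ω(x)`."
(Proof, p. 32: "By (ii) of definition 3.2, we have `ε(x) = ε(y) + 1`. …")

This file PROVES the proposition in the cell's coordinate-centre model (`CentreBlowupAdaptedOrder`: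
`h = Z^q + F(y)`, `G = 0`, constant coefficients, a coordinate centre `C_S`, `J = S`, `J' = Sᶜ`,
`(J')_E = Sᶜ ∩ exc`, `F_{p,Z}` = `initialForm F`, `H_j` = `PointBlowup.bigH F j`), for BOTH typed readings
of Def. 3.2 — `IsSecondKind` (clause (iii) undivided, `CentreBlowupAdaptedOrder`) and `IsSecondKindH`
(clause (iii) with `H_W` divided out, `CentreBlowupTransverseH`):

* (3.3.1), second row: every monomial `y^d` of the initial form `F_{p,Z}` has degree at most one in the
  variables off `S` once `H_W = Π_{u ∈ exc ∖ S} u^{H_u}` is divided out: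
  `Σ_{u ∉ S} d_u ≤ 1 + Σ_{u ∈ exc ∖ S} H_u` (`initialForm_transverseDegree_le_of_isSecondKindH`); in the
  undivided reading the bound is `Σ_{u ∉ S} d_u ≤ 1` (`…_of_isSecondKind`) — the expansion
  `Σ_{j'} U_{j'}Φ_{j'}(U_J) + Ψ(U_J)`;
* "`Φ_{j'} ≠ 0` for some `j' ∈ J' ∖ (J')_E`": the transverse-linear monomial of clause (iii) lies IN the
  initial form (`exists_mem_support_initialForm_of_isSecondKindH`, `…_of_isSecondKind`);
* hence `V(F_{p,Z},E,m_S) ≠ 0` (`vNonzero_of_isSecondKindH`) and "In particular `ε(y) = ω(x)`"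
  (`omega_eq_epsilonAlong_of_isSecondKindH`, `omega_eq_epsilonAlong_of_isSecondKind`);
* the proof's first line "`ε(x) = ε(y) + 1`" unpacked: `ord₀ F = ord_{C_S} F + 1 + Σ_{u ∈ exc∖S} H_u`
  (`ordZero_eq_of_isSecondKindH`);
* a by-product relating the two typed readings: under (ii), the undivided clause (iii) forces `H_u = 0`
  for every boundary variable `u ∉ S` (`bigH_eq_zero_of_isSecondKind`), so `IsSecondKind → IsSecondKindH`
  (`isSecondKindH_of_isSecondKind`) — the undivided reading is the divided one restricted to `H_W ⊆ S`.
The first row of (3.3.1) concerns `G` (`i₀(x) = p − 1`), which is `0` in the model.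

Scope: the MODEL CASE only (our own proof of the cited statement read through the typed Def. 3.2; the
published proposition is about `h ∈ S[Z]` over an excellent regular local ring in well adapted
coordinates).  Calibration: at [CP19] Example 3.1 (`CentreBlowupExample31`) `ω(x) = p = ε(y)`.
Nothing about resolution in general is asserted.  AI-assisted formalisation (observatory `pub-rosobs`,
unit `pub-rosobs-carver-g25`); quotations from arXiv:1412.0868 (PDF page 32).
-/

noncomputable section

open MvPolynomial Finset

open scoped BigOperators

namespace Literature.AlgebraicGeometry.Resolution

open Literature.AlgebraicGeometry.Resolution.Hauser2010
open Literature.AlgebraicGeometry.Resolution.HauserPerlega2019 (initialForm)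
open Literature.Barriers.ResolutionOfSingularities (ordZero_le_of_coeff_ne_zero)

namespace CentreBlowup

/-! ### 0. Private helpers -/

section Helpers

variable {σ : Type*} {K : Type*} [CommRing K]

/-- `H_i ≤ d_i` for every monomial `y^d` of `F`. [folklore] -/
private theorem bigH_le' {F : MvPolynomial σ K} {d : σ →₀ ℕ} (hd : d ∈ F.support) (i : σ) :
    PointBlowup.bigH F i ≤ d i :=
  Finset.inf_le (f := fun d : σ →₀ ℕ => ((d i : ℕ) : ℕ∞)) hd

/-- For `F ≠ 0`, `H_i` is finite. [folklore] -/
private theorem bigH_eq_toNat' {F : MvPolynomial σ K} (hF : F ≠ 0) (i : σ) :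
    PointBlowup.bigH F i = (((PointBlowup.bigH F i).toNat : ℕ) : ℕ∞) := by
  obtain ⟨d, -, h⟩ := Finset.exists_mem_eq_inf F.support (MvPolynomial.support_nonempty.mpr hF)
    (fun d : σ →₀ ℕ => ((d i : ℕ) : ℕ∞))
  rw [show PointBlowup.bigH F i = ((d i : ℕ) : ℕ∞) from h]
  rfl

/-- For `F ≠ 0`, `ord₀ F` is finite. [folklore] -/
private theorem ordZero_eq_toNat' {F : MvPolynomial σ K} (hF : F ≠ 0) :
    ordZero F = (((ordZero F).toNat : ℕ) : ℕ∞) := by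
  have hne : ordZero F ≠ ⊤ := by
    unfold ordZero
    rw [Ne, MvPowerSeries.order_eq_top_iff, MvPolynomial.coe_eq_zero_iff]
    exact hF
  exact (ENat.coe_toNat hne).symm

/-- Casting a finite sum of finite `H_i`. [folklore] -/
private theorem sum_bigH_eq' {F : MvPolynomial σ K} {H : σ → ℕ}
    (hH : ∀ i, PointBlowup.bigH F i = ((H i : ℕ) : ℕ∞)) (T : Finset σ) :
    ∑ i ∈ T, PointBlowup.bigH F i = ((∑ i ∈ T, H i : ℕ) : ℕ∞) := by
  rw [Nat.cast_sum]
  exact Finset.sum_congr rfl fun i _ => hH i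

end Helpers

section Model

variable {σ : Type*} {K : Type*} [Field K] [Fintype σ] [DecidableEq σ]

omit [Fintype σ] in
/-- "By (ii) of definition 3.2, we have `ε(x) = ε(y) + 1`" unpacked in the model: with a monomial `y^{d₀}`
of least `S`-degree and finite `H`, `ord₀ F = deg_S d₀ + 1 + Σ_{u ∈ exc∖S} H_u`. [folklore] -/
private theorem ordZero_toNat_eq_of_ii {S : Finset σ} {s : CState σ K} (hF : s.F ≠ 0)
    (hii : epsilonAlong S s + 1 = s.epsilon) {d₀ : σ →₀ ℕ} (hd₀ : d₀ ∈ s.F.support)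
    (hdeg : (degIn S d₀ : ℕ∞) = ordAlong S s.F) {H : σ → ℕ}
    (hH : ∀ i, PointBlowup.bigH s.F i = ((H i : ℕ) : ℕ∞)) :
    (ordZero s.F).toNat = degIn S d₀ + 1 + ∑ u ∈ s.exc \ S, H u := by
  have ho := ordZero_eq_toNat' hF
  have hHle : ∀ i, H i ≤ d₀ i := fun i => by
    have h := bigH_le' hd₀ i
    rw [hH i] at h
    exact_mod_cast h
  have hA : ∑ i ∈ S ∩ s.exc, H i ≤ degIn S d₀ :=
    le_trans (Finset.sum_le_sum fun i _ => hHle i)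
      (Finset.sum_le_sum_of_subset Finset.inter_subset_left)
  have hBAC : ∑ i ∈ S ∩ s.exc, H i + ∑ i ∈ s.exc \ S, H i = ∑ i ∈ s.exc, H i := by
    rw [Finset.inter_comm]
    exact Finset.sum_inter_add_sum_sdiff s.exc S H
  have hnat : degIn S d₀ - ∑ i ∈ S ∩ s.exc, H i + 1 = (ordZero s.F).toNat - ∑ i ∈ s.exc, H i := by
    have h := hii
    unfold epsilonAlong at h
    rw [CState.epsilon_eq, ← hdeg, ho, sum_bigH_eq' hH, sum_bigH_eq' hH, ← ENat.coe_sub,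
      ← ENat.coe_sub] at h
    exact_mod_cast h
  omega

/-- The data of the `H_W`-divided reading in natural numbers. [folklore] -/
private theorem secondKindH_numbers {q : ℕ} {S : Finset σ} {s : CState σ K} (h2 : IsSecondKindH q S s) :
    ∃ (H : σ → ℕ) (d₀ : σ →₀ ℕ) (t : σ), s.F ≠ 0 ∧
      (∀ i, PointBlowup.bigH s.F i = ((H i : ℕ) : ℕ∞)) ∧ d₀ ∈ s.F.support ∧
      (degIn S d₀ : ℕ∞) = ordAlong S s.F ∧ t ∉ S ∧ t ∉ s.exc ∧ d₀ t = 1 ∧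
      (∑ u ∈ Sᶜ, d₀ u = 1 + ∑ u ∈ s.exc \ S, H u) ∧
      (ordZero s.F).toNat = degIn S d₀ + 1 + ∑ u ∈ s.exc \ S, H u ∧
      d₀.degree = (ordZero s.F).toNat := by
  obtain ⟨-, hii, d₀, hd₀, hdeg, t, ht, htE, hd₀t, hrest⟩ := h2
  have hF : s.F ≠ 0 := by
    intro h
    rw [h, MvPolynomial.support_zero] at hd₀
    exact Finset.notMem_empty d₀ hd₀
  set H : σ → ℕ := fun i => (PointBlowup.bigH s.F i).toNat with hHdef
  have hH : ∀ i, PointBlowup.bigH s.F i = ((H i : ℕ) : ℕ∞) := fun i => bigH_eq_toNat' hF i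
  have ho := ordZero_toNat_eq_of_ii hF hii hd₀ hdeg hH
  have hcompl : ∑ u ∈ Sᶜ, d₀ u = 1 + ∑ u ∈ s.exc \ S, H u := by
    rw [← Finset.add_sum_erase Sᶜ (fun u => d₀ u) (Finset.mem_compl.mpr ht), hd₀t]
    congr 1
    have hset : Sᶜ.erase t ∩ s.exc = s.exc \ S := by
      ext u
      simp only [Finset.mem_inter, Finset.mem_erase, Finset.mem_compl, Finset.mem_sdiff]
      constructor
      · rintro ⟨⟨-, huS⟩, huE⟩
        exact ⟨huE, huS⟩
      · rintro ⟨huE, huS⟩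
        exact ⟨⟨fun h => htE (h ▸ huE), huS⟩, huE⟩
    rw [← hset, ← Finset.sum_ite_mem]
    refine Finset.sum_congr rfl fun u hu => ?_
    obtain ⟨hut, huS⟩ := Finset.mem_erase.mp hu
    have huS' : u ∉ S := Finset.mem_compl.mp huS
    obtain ⟨h0, h1⟩ := hrest u huS' hut
    by_cases huE : u ∈ s.exc
    · rw [if_pos huE]
      have h := h1 huE
      rw [hH u] at h
      exact_mod_cast h
    · rw [if_neg huE]
      exact h0 huE
  refine ⟨H, d₀, t, hF, hH, hd₀, hdeg, ht, htE, hd₀t, hcompl, ho, ?_⟩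
  have h := degIn_add_sum_compl S d₀
  omega

/-! ### 1. The two readings under (ii): the undivided clause (iii) forces `H_W ⊆ S` -/

/-- Under (ii) of Def. 3.2, the undivided reading of (iii) (`HasTransverseLinear`: the transverse-linear
monomial is constant in EVERY other variable off `S`) forces `H_u = 0` for every boundary variable `u ∉ S`:
the monomial has total degree `ord_{C_S} F + 1 = ε(y) + Σ_{S∩E} H + 1 = ε(x) + Σ_{S∩E} H
= ord₀ F − Σ_{E∖S} H_u`, and no monomial has degree `< ord₀ F`. (Model remark relating the cell's two typed
readings of Def. 3.2 (iii).) [cite: CossartPiltant2019, Def. 3.2 (p. 32) with (3.1) (p. 31) and Prop. 3.3 (p. 32)] -/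
theorem bigH_eq_zero_of_isSecondKind {q : ℕ} {S : Finset σ} {s : CState σ K}
    (h2 : IsSecondKind q S s) : ∀ u ∈ s.exc, u ∉ S → PointBlowup.bigH s.F u = 0 := by
  obtain ⟨-, hii, d₀, hd₀, hdeg, t, ht, -, hd₀t, hd₀N⟩ := h2
  have hF : s.F ≠ 0 := by
    intro h
    rw [h, MvPolynomial.support_zero] at hd₀
    exact Finset.notMem_empty d₀ hd₀
  set H : σ → ℕ := fun i => (PointBlowup.bigH s.F i).toNat with hHdef
  have hH : ∀ i, PointBlowup.bigH s.F i = ((H i : ℕ) : ℕ∞) := fun i => bigH_eq_toNat' hF i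
  have ho := ordZero_toNat_eq_of_ii hF hii hd₀ hdeg hH
  have hcompl : ∑ u ∈ Sᶜ, d₀ u = 1 := by
    rw [Finset.sum_eq_single_of_mem t (Finset.mem_compl.mpr ht)
      (fun u hu hut => hd₀N u (Finset.mem_compl.mp hu) hut), hd₀t]
  have hsum := degIn_add_sum_compl S d₀
  have hle : ordZero s.F ≤ d₀.degree :=
    ordZero_le_of_coeff_ne_zero _ d₀ (MvPolynomial.mem_support_iff.mp hd₀)
  rw [ordZero_eq_toNat' hF] at hle
  have hle' : (ordZero s.F).toNat ≤ d₀.degree := by exact_mod_cast hle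
  have hC : ∑ u ∈ s.exc \ S, H u = 0 := by omega
  intro u huE huS
  have hu : H u ≤ ∑ u ∈ s.exc \ S, H u :=
    Finset.single_le_sum (fun _ _ => Nat.zero_le _) (Finset.mem_sdiff.mpr ⟨huE, huS⟩)
  have hu0 : H u = 0 := by omega
  rw [hH u, hu0, Nat.cast_zero]

/-- Hence a centre of the second kind in the undivided reading is one in the `H_W`-divided reading
(`CentreBlowupTransverseH`). [cite: CossartPiltant2019, Def. 3.2 (p. 32) with (3.1) (p. 31)] -/
theorem isSecondKindH_of_isSecondKind {q : ℕ} {S : Finset σ} {s : CState σ K}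
    (h2 : IsSecondKind q S s) : IsSecondKindH q S s :=
  (isSecondKindH_iff_of_bigH_eq_zero q S s (bigH_eq_zero_of_isSecondKind h2)).mpr h2

/-! ### 2. "`ε(x) = ε(y) + 1`" unpacked -/

/-- The first line of the proof of Prop. 3.3 in the model: at a centre of the second kind,
`ord₀ F = ord_{C_S} F + 1 + Σ_{u ∈ exc ∖ S} H_u` (all quantities finite).
[cite: CossartPiltant2019, Prop. 3.3 (p. 32), proof ("By (ii) … ε(x) = ε(y)+1")] -/
theorem ordZero_eq_of_isSecondKindH {q : ℕ} {S : Finset σ} {s : CState σ K} (h2 : IsSecondKindH q S s) :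
    ordZero s.F = ordAlong S s.F + 1 + ∑ u ∈ s.exc \ S, PointBlowup.bigH s.F u := by
  obtain ⟨H, d₀, t, hF, hH, -, hdeg, -, -, -, -, ho, -⟩ := secondKindH_numbers h2
  rw [ordZero_eq_toNat' hF, ho, ← hdeg, sum_bigH_eq' hH]
  push_cast
  ring

/-! ### 3. (3.3.1): the initial form is at most linear off `S` after dividing by `H_W` -/

/-- **(3.3.1), second row, in the model**: at a centre of the second kind (divided reading) every monomial
`y^d` of the initial form `F_{p,Z}` satisfies `Σ_{u ∉ S} d_u ≤ 1 + Σ_{u ∈ exc∖S} H_u` — i.e.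
`H_W⁻¹ F_{p,Z} = Σ_{j'∈J'} U_{j'} Φ_{j'}(U_J) + Ψ(U_J)` is at most linear in the variables off the centre.
[cite: CossartPiltant2019, Prop. 3.3 (p. 32), (3.3.1)] -/
theorem initialForm_transverseDegree_le_of_isSecondKindH {q : ℕ} {S : Finset σ} {s : CState σ K}
    (h2 : IsSecondKindH q S s) :
    ∀ d ∈ (initialForm s.F).support,
      ((∑ u ∈ Sᶜ, d u : ℕ) : ℕ∞) ≤ 1 + ∑ u ∈ s.exc \ S, PointBlowup.bigH s.F u := by
  obtain ⟨H, d₀, t, hF, hH, -, hdeg, -, -, -, -, ho, -⟩ := secondKindH_numbers h2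
  intro d hd
  have hc := MvPolynomial.mem_support_iff.mp hd
  unfold HauserPerlega2019.initialForm at hc
  rw [coeff_homogeneousComponent] at hc
  by_cases hdo : d.degree = (ordZero s.F).toNat
  · rw [if_pos hdo] at hc
    have hdF : d ∈ s.F.support := MvPolynomial.mem_support_iff.mpr hc
    have hmin : degIn S d₀ ≤ degIn S d := by
      have h : ordAlong S s.F ≤ (degIn S d : ℕ∞) := Finset.inf_le hdF
      rw [← hdeg] at h
      exact_mod_cast h
    have hsum := degIn_add_sum_compl S d
    rw [sum_bigH_eq' hH, ← ENat.coe_one, ← ENat.coe_add]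
    exact_mod_cast (by omega : ∑ u ∈ Sᶜ, d u ≤ 1 + ∑ u ∈ s.exc \ S, H u)
  · exact absurd (by rw [if_neg hdo]) hc

/-- The same in the undivided reading: every monomial of `F_{p,Z}` has degree `≤ 1` off `S`
(`F_{p,Z} = Σ_{j'} U_{j'}Φ_{j'}(U_J) + Ψ(U_J)`, `H = 1` off `S`). [cite: CossartPiltant2019, Prop. 3.3 (p. 32), (3.3.1)] -/
theorem initialForm_transverseDegree_le_of_isSecondKind {q : ℕ} {S : Finset σ} {s : CState σ K}
    (h2 : IsSecondKind q S s) : ∀ d ∈ (initialForm s.F).support, ∑ u ∈ Sᶜ, d u ≤ 1 := by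
  intro d hd
  have h0 := bigH_eq_zero_of_isSecondKind h2
  have h := initialForm_transverseDegree_le_of_isSecondKindH (isSecondKindH_of_isSecondKind h2) d hd
  rw [Finset.sum_eq_zero (fun u hu => h0 u (Finset.mem_sdiff.mp hu).1 (Finset.mem_sdiff.mp hu).2),
    add_zero] at h
  exact_mod_cast h

/-! ### 4. "`Φ_{j'} ≠ 0` for some `j' ∈ J' ∖ (J')_E`" -/

/-- **`Φ_{j'} ≠ 0` for a non-boundary `j'`** (divided reading): the transverse-linear monomial of clause
(iii) has total degree `ord₀ F`, so it is a monomial OF THE INITIAL FORM `F_{p,Z}`, linear in the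
non-boundary transverse variable `t`. [cite: CossartPiltant2019, Prop. 3.3 (p. 32)] -/
theorem exists_mem_support_initialForm_of_isSecondKindH {q : ℕ} {S : Finset σ} {s : CState σ K}
    (h2 : IsSecondKindH q S s) :
    ∃ d ∈ (initialForm s.F).support, (degIn S d : ℕ∞) = ordAlong S s.F ∧
      ∃ t, t ∉ S ∧ t ∉ s.exc ∧ d t = 1 := by
  obtain ⟨H, d₀, t, hF, hH, hd₀, hdeg, ht, htE, hd₀t, -, -, hdegd₀⟩ := secondKindH_numbers h2
  refine ⟨d₀, ?_, hdeg, t, ht, htE, hd₀t⟩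
  rw [MvPolynomial.mem_support_iff]
  unfold HauserPerlega2019.initialForm
  rw [coeff_homogeneousComponent, if_pos hdegd₀]
  exact MvPolynomial.mem_support_iff.mp hd₀

/-- The same in the undivided reading. [cite: CossartPiltant2019, Prop. 3.3 (p. 32)] -/
theorem exists_mem_support_initialForm_of_isSecondKind {q : ℕ} {S : Finset σ} {s : CState σ K}
    (h2 : IsSecondKind q S s) :
    ∃ d ∈ (initialForm s.F).support, (degIn S d : ℕ∞) = ordAlong S s.F ∧
      ∃ t, t ∉ S ∧ t ∉ s.exc ∧ d t = 1 :=
  exists_mem_support_initialForm_of_isSecondKindH (isSecondKindH_of_isSecondKind h2)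

/-! ### 5. `V(F_{p,Z},E,m_S) ≠ 0` and "In particular `ε(y) = ω(x)`" -/

/-- At a centre of the second kind `V(F_{p,Z},E,m_S) ≠ 0`: `∂F_{p,Z}/∂u_t ≠ 0` for the non-boundary
transverse variable `t` of clause (iii). [cite: CossartPiltant2019, Prop. 3.3 (p. 32) with Def. 2.16 (p. 24)] -/
theorem vNonzero_of_isSecondKindH {q : ℕ} {S : Finset σ} {s : CState σ K} (h2 : IsSecondKindH q S s) :
    PointBlowup.VNonzero s.exc s.F := by
  obtain ⟨H, d₀, t, hF, hH, hd₀, hdeg, ht, htE, hd₀t, -, -, hdegd₀⟩ := secondKindH_numbers h2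
  have hcoeff := MvPolynomial.mem_support_iff.mp hd₀
  refine ⟨t, htE, fun h0 => ?_⟩
  have h1 := congrArg (coeff (d₀ - Finsupp.single t 1)) h0
  have hle1 : Finsupp.single t 1 ≤ d₀ := Finsupp.single_le_iff.mpr (by rw [hd₀t])
  have hdt' : (d₀ - Finsupp.single t 1 : σ →₀ ℕ) t = 0 := by
    rw [Finsupp.tsub_apply, Finsupp.single_eq_same, hd₀t]
  rw [MvPolynomial.coeff_pderiv, coeff_zero, tsub_add_cancel_of_le hle1, hdt'] at h1
  unfold HauserPerlega2019.initialForm at h1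
  rw [coeff_homogeneousComponent, if_pos hdegd₀] at h1
  apply hcoeff
  simpa using h1

/-- The same in the undivided reading. [cite: CossartPiltant2019, Prop. 3.3 (p. 32) with Def. 2.16 (p. 24)] -/
theorem vNonzero_of_isSecondKind {q : ℕ} {S : Finset σ} {s : CState σ K} (h2 : IsSecondKind q S s) :
    PointBlowup.VNonzero s.exc s.F :=
  vNonzero_of_isSecondKindH (isSecondKindH_of_isSecondKind h2)

/-- **"In particular `ε(y) = ω(x)`"** (divided reading): `ω(x) = ε(x) − 1 = ε(y)`.
[cite: CossartPiltant2019, Prop. 3.3 (p. 32)] -/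
theorem omega_eq_epsilonAlong_of_isSecondKindH {q : ℕ} {S : Finset σ} {s : CState σ K}
    (h2 : IsSecondKindH q S s) : s.omega = epsilonAlong S s := by
  rw [CState.omega_eq_of_vNonzero _ (vNonzero_of_isSecondKindH h2), ← h2.2.1]
  exact (ENat.addLECancellable_of_ne_top ENat.one_ne_top).add_tsub_cancel_right

/-- **"In particular `ε(y) = ω(x)`"** at a permissible centre of the second kind (undivided reading,
the cell's `IsSecondKind`). [cite: CossartPiltant2019, Prop. 3.3 (p. 32)] -/
theorem omega_eq_epsilonAlong_of_isSecondKind {q : ℕ} {S : Finset σ} {s : CState σ K}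
    (h2 : IsSecondKind q S s) : s.omega = epsilonAlong S s :=
  omega_eq_epsilonAlong_of_isSecondKindH (isSecondKindH_of_isSecondKind h2)

/-- … equivalently `ω(x) + 1 = ε(x)` there (`ω` drops the `1` exactly). [cite: CossartPiltant2019, Prop. 3.3 (p. 32) with Def. 3.2 (ii)] -/
theorem omega_add_one_eq_epsilon_of_isSecondKindH {q : ℕ} {S : Finset σ} {s : CState σ K}
    (h2 : IsSecondKindH q S s) : s.omega + 1 = s.epsilon := by
  rw [omega_eq_epsilonAlong_of_isSecondKindH h2]
  exact h2.2.1

end Model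

/-! ### 6. Calibration: [CP19] Example 3.1 -/

section Calibration

variable {K : Type*} [Field K]

/-- At the second-kind curve of [CP19] Example 3.1 the proposition gives `ω(x) = ε(y) = p`, as computed
in `CentreBlowupExample31`. [cite: CossartPiltant2019, Example 3.1 (p. 32) with Prop. 3.3 (p. 32)] -/
theorem cp19Example31_omega_eq_epsilonAlong (p : ℕ) :
    (cp19Example31 p : CState (Fin 3) K).omega =
      epsilonAlong cp19Example31Centre (cp19Example31 p : CState (Fin 3) K) :=
  omega_eq_epsilonAlong_of_isSecondKind (cp19Example31_isSecondKind p)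

end Calibration

end CentreBlowup

end Literature.AlgebraicGeometry.Resolution

end
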